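import Summits.BirchSwinnertonDyer.BirchSwinnertonDyer.Theorems.ByReductionTypeAtTwoMultTransportTwistedDescentSingle
import Summits.BirchSwinnertonDyer.BirchSwinnertonDyer.Theorems.ByReductionTypeAtTwoMultTransportTwistedLiftUnramified
import HarnessLib

/-!
# T-42-mult in the kernel, XXI: `LIFT₁` follows from its LEVEL-`ℚ` form `LIFT₂`
# (the remaining content of `hF3b` is the existence of twisted classes over `ℚ` with prescribed local images)

Cell `bsd-2adic` (run/shared/lean/pub/bsd-2adic/), seat `bsd-2adic-t42` (BRIEF-T42), GEN 15. HONEST FRAMING: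
research route; THEOREMS ONLY (no `def`, no named fact, no instance); nothing booked; nothing re-keyed
(RC-169); BSD is not proved by any of this. PARTITION: X5@2 multiplicative GV-transport rows (K4ᵐ B1·O1; the
residual `LIFT₁` of `hF3b`, file XIX `…TwistedDescentSingle.lean` :233–256) × p = 2 — types-the-object-of;
bears_on K4 items 19922 / 19923 (`--supports stmt-BirchSwinnertonDyer-19923`). Brick (ζ) (assembly half) of
HOME/t42/DESIGN-T42-ADDENDUM-16.md.

## What

`LIFT₁` (file XIX) asks, for all but finitely many odd `u` and every `c ∈ H = H¹(ℚ_Σ/ℚ_∞, E[2^∞])` whose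
`ψ_u c = u·conj_γ c − c` is Kummer at THE place above `2` and at THE real place, for a `ψ_u`-invariant
`c' ∈ H` with `c' − c` Kummer at those two places. The glue landed in GEN 15 makes every class
`c' = twistedTorsionToH1 x`, `x ∈ H¹(Γ_ℚ, E[2^J](χ_u))` (file `ZpExtensionGaloisTwistRestrict`), satisfy:
`ψ_u c' = 0` ALWAYS (`zsmul_conjH1_twistedTorsionToH1_sub_self`); `c' ∈ H` as soon as `x` is unramified
outside `S₀ ∪ {2, ∞}` at level `ℚ` (file XX `twistedTorsionToH1_mem_unramifiedOutside`); `c' − c` Kummer at a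
completion `E` iff the level-`ℚ` local class of `x` maps to `loc_E c` (`twistedTorsionToH1_sub_mem_localKerOver_iff`,
file `ZpExtensionGaloisTwistLocal`). Hence:

* `liftSingle_of_levelLift : LIFT₂ → LIFT₁`, where `LIFT₂` is `LIFT₁` with the conclusion replaced by
  «∃ J, ∃ x ∈ H¹(Γ_ℚ, E[2^J](χ_u)) unramified outside `S₀ ∪ {2, ∞}` with
  `twistedTorsionToLocalH1 (loc_v x) = localResOver_v c` at the place `v ∋ 2` and at the real place» — a
  statement about Galois cohomology OVER `ℚ` of the finite modules `E[2^J](χ_u)` (the currency of the tree's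
  Poitou–Tate fact `poitouTate_selmerStructure_duality`), with no `conj`, no `K_∞`-side condition left;
* `hF3b_of_prop49_level : P49 → LIFT₂ → hF3b` (composition with file XIX).

What remains of `hF3b` after this file: `LIFT₂` = (γ₂) the target class at `2` + (δ)/(β) the Poitou–Tate
lifting with vanishing obstruction ((ε-2) `ZpExtension.finite_setOf_twisted_eigenvector` landed) — memo A16.8.

References: [GreenbergLNM1716] §4 pp. 107, 122–126; [GreenbergVatsal2000] §2 pp. 16–17.
-/

set_option autoImplicit false
set_option linter.dupNamespace false

noncomputable section

open scoped Classical

universe u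

namespace Summit.BirchSwinnertonDyer.BirchSwinnertonDyer.Theorems.MultTransportTwistedDescent

open NumberField IsDedekindDomain Field WeierstrassCurve
  Literature.NumberTheory.EllipticCurves Literature.NumberTheory.EllipticCurves.GreenbergVatsal2000
  Literature.NumberTheory.EllipticCurves.Greenberg1999
  Literature.NumberTheory.GaloisRepresentations
  Summit.BirchSwinnertonDyer.BirchSwinnertonDyer.Theorems.MultTransportAtTwo

/-- **`liftSingle_of_levelLift : LIFT₂ → LIFT₁`.** If, for all but finitely many odd `u`, every `c ∈ H`
with `ψ_u c` Kummer at the place above `2` and at the real place admits a level `J` and a class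
`x ∈ H¹(Γ_ℚ, E[2^J](χ_u))` unramified outside `S₀ ∪ {2, ∞}` whose local classes map to `loc_v c` at those two
places, then `LIFT₁` holds: `c' := twistedTorsionToH1 x` works (`twistedTorsionToH1_mem_unramifiedOutside`,
`zsmul_conjH1_twistedTorsionToH1_sub_self`, `twistedTorsionToH1_sub_mem_localKerOver_iff`). The bad set of
`LIFT₁` is contained in the bad set of `LIFT₂`, `u` by `u`.
[cite: GreenbergLNM1716, §4 pp. 107, 124] [cite: GreenbergVatsal2000, §2 pp. 16–17] -/
theorem liftSingle_of_levelLift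
    (LIFT₂ : ∀ (W : WeierstrassCurve ℚ) [W.IsElliptic] [W.IsGloballyMinimal],
      W.HasMultiplicativeReductionAtPrime 2 →
      ∀ (κ : ZpExtension ℚ 2) (_hκ : κ.IsCyclotomic) (γ : absoluteGaloisGroup ℚ)
        (_hγ : κ.IsTopGenerator γ) (S₀ : Finset (HeightOneSpectrum (𝓞 ℚ)))
        (_hne : S₀.Nonempty)
        (_hS₀ : ∀ v ∈ S₀, ((2 : ℕ) : 𝓞 ℚ) ∉ v.asIdeal)
        (_hbad : ∀ v : HeightOneSpectrum (𝓞 ℚ), v ∉ S₀ → ((2 : ℕ) : 𝓞 ℚ) ∉ v.asIdeal →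
          W.HasGoodReductionAt v)
        (D : W.SelmerDualData κ γ) [Module.Finite (IwasawaAlgebra 2) D.X], D.IsTorsion →
      {u : ℤ | (2 : ℤ) ∣ u - 1 ∧
        ¬ ∀ c ∈ unramifiedOutside κ.kerSubgroup (W.geomPrimaryTorsion 2) 2
            (↑S₀ : Set (HeightOneSpectrum (𝓞 ℚ))),
        (∀ v ∈ {v : HeightOneSpectrum (𝓞 ℚ) | ((2 : ℕ) : 𝓞 ℚ) ∈ v.asIdeal},
            u • W.conjH1 2 κ.kerSubgroup γ c - c ∈ W.localKerOver 2 κ.kerSubgroup (v.adicCompletion ℚ)) →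
        (∀ w : InfinitePlace ℚ,
            u • W.conjH1 2 κ.kerSubgroup γ c - c ∈ W.localKerOver 2 κ.kerSubgroup w.Completion) →
        ∃ (hu : (2 : ℤ) ∣ u - 1) (J : ℕ)
          (x : galoisCohomology (W.twistedTorsionGaloisModule 2 κ J u hu) 1),
          (∀ v : HeightOneSpectrum (𝓞 ℚ), v ∉ S₀ → ((2 : ℕ) : 𝓞 ℚ) ∉ v.asIdeal →
            galoisCohomology.res (W.twistedTorsionGaloisModule 2 κ J u hu) (v.adicCompletion ℚ) 1 x ∈
              DiscreteGaloisModule.unramifiedSubgroup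
                ((W.twistedTorsionGaloisModule 2 κ J u hu).restrictField (v.adicCompletion ℚ)) 1) ∧
          (∀ v ∈ {v : HeightOneSpectrum (𝓞 ℚ) | ((2 : ℕ) : 𝓞 ℚ) ∈ v.asIdeal},
            W.twistedTorsionToLocalH1 2 κ J u hu (v.adicCompletion ℚ)
                (galoisCohomology.res (W.twistedTorsionGaloisModule 2 κ J u hu) (v.adicCompletion ℚ) 1 x) =
              W.localResOver 2 κ.kerSubgroup (v.adicCompletion ℚ) c) ∧
          (∀ w : InfinitePlace ℚ,
            W.twistedTorsionToLocalH1 2 κ J u hu w.Completion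
                (galoisCohomology.res (W.twistedTorsionGaloisModule 2 κ J u hu) w.Completion 1 x) =
              W.localResOver 2 κ.kerSubgroup w.Completion c)}.Finite) :
    ∀ (W : WeierstrassCurve ℚ) [W.IsElliptic] [W.IsGloballyMinimal],
      W.HasMultiplicativeReductionAtPrime 2 →
      ∀ (κ : ZpExtension ℚ 2) (_hκ : κ.IsCyclotomic) (γ : absoluteGaloisGroup ℚ)
        (_hγ : κ.IsTopGenerator γ) (S₀ : Finset (HeightOneSpectrum (𝓞 ℚ)))
        (_hne : S₀.Nonempty)
        (_hS₀ : ∀ v ∈ S₀, ((2 : ℕ) : 𝓞 ℚ) ∉ v.asIdeal)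
        (_hbad : ∀ v : HeightOneSpectrum (𝓞 ℚ), v ∉ S₀ → ((2 : ℕ) : 𝓞 ℚ) ∉ v.asIdeal →
          W.HasGoodReductionAt v)
        (D : W.SelmerDualData κ γ) [Module.Finite (IwasawaAlgebra 2) D.X], D.IsTorsion →
      {u : ℤ | (2 : ℤ) ∣ u - 1 ∧
        ¬ ∀ c ∈ unramifiedOutside κ.kerSubgroup (W.geomPrimaryTorsion 2) 2
            (↑S₀ : Set (HeightOneSpectrum (𝓞 ℚ))),
        (∀ v ∈ {v : HeightOneSpectrum (𝓞 ℚ) | ((2 : ℕ) : 𝓞 ℚ) ∈ v.asIdeal},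
            u • W.conjH1 2 κ.kerSubgroup γ c - c ∈ W.localKerOver 2 κ.kerSubgroup (v.adicCompletion ℚ)) →
        (∀ w : InfinitePlace ℚ,
            u • W.conjH1 2 κ.kerSubgroup γ c - c ∈ W.localKerOver 2 κ.kerSubgroup w.Completion) →
        ∃ c' ∈ unramifiedOutside κ.kerSubgroup (W.geomPrimaryTorsion 2) 2
            (↑S₀ : Set (HeightOneSpectrum (𝓞 ℚ))),
          u • W.conjH1 2 κ.kerSubgroup γ c' - c' = 0 ∧
          (∀ v ∈ {v : HeightOneSpectrum (𝓞 ℚ) | ((2 : ℕ) : 𝓞 ℚ) ∈ v.asIdeal},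
              c' - c ∈ W.localKerOver 2 κ.kerSubgroup (v.adicCompletion ℚ)) ∧
          (∀ w : InfinitePlace ℚ, c' - c ∈ W.localKerOver 2 κ.kerSubgroup w.Completion)}.Finite := by
  intro W _ _ hW κ hκ γ hγ S₀ hne hS₀ hbad D _ hD
  refine (LIFT₂ W hW κ hκ γ hγ S₀ hne hS₀ hbad D hD).subset fun u hu ↦ ⟨hu.1, fun hall ↦ hu.2 ?_⟩
  intro c hc h2 hinf
  obtain ⟨hu', J, x, hxur, hx2, hxinf⟩ := hall c hc h2 hinf
  refine ⟨W.twistedTorsionToH1 2 κ J u hu' x,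
    twistedTorsionToH1_mem_unramifiedOutside W 2 κ J u hu' ↑S₀ x (fun v hv hv2 ↦ hxur v hv hv2),
    W.zsmul_conjH1_twistedTorsionToH1_sub_self 2 κ J u hu' hγ x, fun v hv ↦ ?_, fun w ↦ ?_⟩
  · exact (W.twistedTorsionToH1_sub_mem_localKerOver_iff 2 κ J u hu' (v.adicCompletion ℚ) x c).mpr
      (hx2 v hv)
  · exact (W.twistedTorsionToH1_sub_mem_localKerOver_iff 2 κ J u hu' w.Completion x c).mpr (hxinf w)

/-- **`hF3b` from PRINT-by-name {Prop. 4.9} + the level-`ℚ` lifting `LIFT₂`** (composition with file XIX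
`hF3b_of_prop49_single`). Record-only per RC-169 (no display is re-keyed).
[cite: GreenbergLNM1716, §4 Prop. 4.9, pp. 122–126] -/
theorem hF3b_of_prop49_level (h49 : prop49_noFiniteSubmodule_H1Sigma)
    (LIFT₂ : ∀ (W : WeierstrassCurve ℚ) [W.IsElliptic] [W.IsGloballyMinimal],
      W.HasMultiplicativeReductionAtPrime 2 →
      ∀ (κ : ZpExtension ℚ 2) (_hκ : κ.IsCyclotomic) (γ : absoluteGaloisGroup ℚ)
        (_hγ : κ.IsTopGenerator γ) (S₀ : Finset (HeightOneSpectrum (𝓞 ℚ)))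
        (_hne : S₀.Nonempty)
        (_hS₀ : ∀ v ∈ S₀, ((2 : ℕ) : 𝓞 ℚ) ∉ v.asIdeal)
        (_hbad : ∀ v : HeightOneSpectrum (𝓞 ℚ), v ∉ S₀ → ((2 : ℕ) : 𝓞 ℚ) ∉ v.asIdeal →
          W.HasGoodReductionAt v)
        (D : W.SelmerDualData κ γ) [Module.Finite (IwasawaAlgebra 2) D.X], D.IsTorsion →
      {u : ℤ | (2 : ℤ) ∣ u - 1 ∧
        ¬ ∀ c ∈ unramifiedOutside κ.kerSubgroup (W.geomPrimaryTorsion 2) 2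
            (↑S₀ : Set (HeightOneSpectrum (𝓞 ℚ))),
        (∀ v ∈ {v : HeightOneSpectrum (𝓞 ℚ) | ((2 : ℕ) : 𝓞 ℚ) ∈ v.asIdeal},
            u • W.conjH1 2 κ.kerSubgroup γ c - c ∈ W.localKerOver 2 κ.kerSubgroup (v.adicCompletion ℚ)) →
        (∀ w : InfinitePlace ℚ,
            u • W.conjH1 2 κ.kerSubgroup γ c - c ∈ W.localKerOver 2 κ.kerSubgroup w.Completion) →
        ∃ (hu : (2 : ℤ) ∣ u - 1) (J : ℕ)
          (x : galoisCohomology (W.twistedTorsionGaloisModule 2 κ J u hu) 1),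
          (∀ v : HeightOneSpectrum (𝓞 ℚ), v ∉ S₀ → ((2 : ℕ) : 𝓞 ℚ) ∉ v.asIdeal →
            galoisCohomology.res (W.twistedTorsionGaloisModule 2 κ J u hu) (v.adicCompletion ℚ) 1 x ∈
              DiscreteGaloisModule.unramifiedSubgroup
                ((W.twistedTorsionGaloisModule 2 κ J u hu).restrictField (v.adicCompletion ℚ)) 1) ∧
          (∀ v ∈ {v : HeightOneSpectrum (𝓞 ℚ) | ((2 : ℕ) : 𝓞 ℚ) ∈ v.asIdeal},
            W.twistedTorsionToLocalH1 2 κ J u hu (v.adicCompletion ℚ)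
                (galoisCohomology.res (W.twistedTorsionGaloisModule 2 κ J u hu) (v.adicCompletion ℚ) 1 x) =
              W.localResOver 2 κ.kerSubgroup (v.adicCompletion ℚ) c) ∧
          (∀ w : InfinitePlace ℚ,
            W.twistedTorsionToLocalH1 2 κ J u hu w.Completion
                (galoisCohomology.res (W.twistedTorsionGaloisModule 2 κ J u hu) w.Completion 1 x) =
              W.localResOver 2 κ.kerSubgroup w.Completion c)}.Finite) :
    ∀ (W : WeierstrassCurve ℚ) [W.IsElliptic] [W.IsGloballyMinimal],
      W.HasMultiplicativeReductionAtPrime 2 →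
      ∀ (κ : ZpExtension ℚ 2) (_hκ : κ.IsCyclotomic) (γ : absoluteGaloisGroup ℚ)
        (_hγ : κ.IsTopGenerator γ) (S₀ : Finset (HeightOneSpectrum (𝓞 ℚ)))
        (_hne : S₀.Nonempty)
        (_hS₀ : ∀ v ∈ S₀, ((2 : ℕ) : 𝓞 ℚ) ∉ v.asIdeal)
        (_hbad : ∀ v : HeightOneSpectrum (𝓞 ℚ), v ∉ S₀ → ((2 : ℕ) : 𝓞 ℚ) ∉ v.asIdeal →
          W.HasGoodReductionAt v)
        (D : W.SelmerDualData κ γ) [Module.Finite (IwasawaAlgebra 2) D.X], D.IsTorsion →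
        ∀ (DS : NonPrimitiveDualData W κ γ (↑S₀ : Set (HeightOneSpectrum (𝓞 ℚ))))
          (N : Submodule (IwasawaAlgebra 2) DS.X), Finite N → N = ⊥ :=
  hF3b_of_prop49_single h49 (liftSingle_of_levelLift LIFT₂)

end Summit.BirchSwinnertonDyer.BirchSwinnertonDyer.Theorems.MultTransportTwistedDescent

end
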